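import Summits.BirchSwinnertonDyer.Rank1Residual.X10.MainConjectureBinderFree
import Literature.NumberTheory.EllipticCurves.GreenbergVatsal2000.CongruentCurves
import Literature.NumberTheory.EllipticCurves.PAdicBSDProofs
import Literature.NumberTheory.EllipticCurves.IwasawaAlgebraCharIdealProofs
import HarnessLib

/-!
# The `μ`-ZERO ROAD (odd good ordinary `p`, `E[p]` irreducible, ANY image, rank `0`): Greenberg's `μ = 0`
# at the pair ALONE turns Kato's RATIONAL divisibility (Thm. 17.4 (2)) into the INTEGRAL one — hence
# the Euler-system half `ord_p #Ш ≤ ord_p #Ш_an` and (main conjecture ⟺ typed lower bound ⟺ `BSD(E,p)`)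
# with no surjectivity, no (ram), no rational main conjecture (cell `b2b-bsdres`, unit `b2b-bsdres-x10`
# = N2 class lead, GEN 34; TOOL, part 1 of 2 — theorems only, no definition, no named fact, nothing booked)

HONEST FRAMING (run/shared/lean/b2b/bsd-rank1-residual/, verbatim in every file): the goal of the
cell is to DELETE the COMBINATION-SHAPED residual classes of the Birch–Swinnerton-Dyer formula for
ALL analytic-rank `≤ 1` elliptic curves over `ℚ` — "full BSD formula for every rank `≤ 1` curve in
class `C`" assembled STRICTLY from published theorems — so that the rank-`≤ 1` remainder becomes
exactly the CONSTRUCTION-SHAPED classes, which are TYPED (missing-input `Prop`s), NOT attempted.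
This is not "finishing BSD". Class X10b (N2: `p = 3` good ordinary, `E[3]` irreducible with image a
Cartan normaliser) keeps its label CONSTRUCTION-SHAPED / NEEDS X_A3 (RESIDUAL-MAP §I N2); nothing is
booked by this file; no census number moves.

## What (x10 GEN 34, X10-AUDIT §40)

On N2 no printed theorem gives EITHER half of `BSD(E,3)` at the class level: Kato's INTEGRAL clause
Thm. 17.4 (3) wants `ρ_{E,3^∞}` onto (condition (12.5.2)); Wuthrich 2014 Prop. 21 exempts exactly the
primes whose image is "neither surjective nor contained in a Borel"; Skinner–Urban needs (ram), which a
Cartan-normaliser image negates (`ClassX10.not_ram_of_not_surj`). What Kato DOES print for every image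
is clause (2): `X(E/ℚ_∞)` is `Λ`-torsion and `p^n · L_p(E,T) ∈ ι(char_Λ X)` for some `n ≥ 0` (tree fact
`kato_divisibility`, clause 2). THIS FILE: if Greenberg's conjecture `μ(X(E/ℚ_∞)) = 0` (LNM 1716 Conj.
1.11 — "`E[p]` irreducible ⟹ `μ_E = 0`", OPEN, in print as a conjecture) holds AT THE PAIR, clause (2)
is already the integral divisibility: with `char_Λ X = (f_E)`, `p ∤ f_E` (`μ = 0` ⟺ unit content,
Greenberg–Vatsal (2)), `p^n L_p = ι(h · f_E)` and `L_p ∈ Λ` (`E[p]` irreducible, Greenberg–Vatsal Prop.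
3.7, a tree theorem), the prime `p` of the UFD `Λ = ℤ_p⟦T⟧` divides `h` `n` times, so `L_p = ι(h'· f_E)`
with `h' · f_E ∈ char_Λ X`. Feeding this datum to the cell's generic chain (`chain_of_divisibility`, X10
gen 5: interpolation `g(0) = (1 - α⁻¹)² L(E,1)/Ω`, Greenberg's Thm. 4.1, the anomalous factor cancels):

* `divisibility_of_kato_of_mu_eq_zero` — Kato (2) + `D.mu = 0` ⟹ the Néron-normalised INTEGRAL
  divisibility datum `ι g = ϖ · L_p(f, α)`, `g ∈ char_Λ X`;
* `missingUpperBoundAt_of_kato_of_greenbergMu` — **`μ = 0` ⟹ `ord_p #Ш(E/ℚ) ≤ ord_p #Ш(E/ℚ)_an`**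
  (the Euler-system half, `Typed.MissingUpperBoundAt W p`);
* `mainConjecture_of_missingLowerBoundAt_of_kato_of_greenbergMu`, `mainConjecture_of_bsdp_of_kato_of_greenbergMu`,
  `mainConjecture_iff_missingLowerBoundAt_of_kato_of_greenbergMu`, `mainConjecture_iff_bsdp_of_kato_of_greenbergMu`
  — **`μ = 0` ⟹ (Mazur's main conjecture ⟺ the typed lower bound ⟺ Miller's `BSD(E,p)`)**;
* `mu_eq_zero_of_mainConjectureAt_of_cert` — the converse bookkeeping (main conjecture at a datum + one
  unit coefficient of `ϖ · L_p` ⟹ `μ = 0` there).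

Part 2 (`X10/MuZeroRoadThree.lean`) instantiates these on class X10 ∩ {r = 0} at `p = 3` (X10a′ AND
X10b). READING for N2: the rank-`0` residue X_A3 splits as (Greenberg's `μ = 0` ⟹ the Euler-system half)
∧ (the lower half = the Skinner–Urban direction); per pair, with `BSD(E,3)` booked by the lane's
certificates, X_A3 at the pair IS Greenberg's Conj. 1.11 at the pair. Compare x10 GEN 6
`X10b.bsdp_iff_mu_eq_zero` (two-sided RATIONAL main conjecture, Yan–Zhu Thm. 4.9, flag YZ26@3) and
rmap-1's `CornersGreenbergMu` at `p ≥ 5` (BCS 2025 (a)): here ONE-sided Kato (2) suffices for everything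
except `μ = 0 ⟹ BSDp`, which is NOT claimed. Displayed PUBLISHED binders: `kato_divisibility` (only
clause 2 is used), Greenberg Thm. 4.1 (`hGr`), modularity (`hmod`), GZK (`hGZK`), period unit (`hϖ`).
The rank-1 half is NOT touched.

References: [Kato2004Asterisque] Thm. 17.4 (2) (p. 273); [GreenbergLNM1716] Conj. 1.11, Thm. 4.1, §5;
[GreenbergVatsal2000] p. 2 (1)–(2), Prop. (3.7); [Wuthrich2014] Prop. 21; [SkinnerUrban2014] Thm. 3.6.9;
[Miller2011LMS] Def. 1.1; [Washington1997] §13.1; cell files X10-AUDIT.md §8, §11, §40,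
`Literature/…/Rank1Residual/X10MainConjecture.lean`.
-/

set_option autoImplicit false

noncomputable section

open scoped Classical MatrixGroups ModularForm

open CongruenceSubgroup WeierstrassCurve Literature.NumberTheory.EllipticCurves
  Literature.NumberTheory.EllipticCurves.ModularForms Literature.NumberTheory.EllipticCurves.Rank1Residual
  Literature.NumberTheory.EllipticCurves.Rank1Residual.Typed
  Literature.NumberTheory.EllipticCurves.Wuthrich2014
  Summit.BirchSwinnertonDyer.BirchSwinnertonDyer.Theorems.Rank1ResidualX1Defs

namespace Summit.BirchSwinnertonDyer.Rank1Residual.X10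

/-! ### §1. Kato's clause (2) + `μ = 0` supplies the integral divisibility datum (any image) -/

/-- **Kato Thm. 17.4 (2) + Greenberg's `μ = 0` ⟹ the Néron-normalised INTEGRAL divisibility datum**, at
an odd good ordinary prime `p` with `E[p]` irreducible (any image). Kato (`hK`, named fact
`kato_divisibility`, clause 2): `X` torsion and `ι g₀ = p^n · L_p(f, α)` for some `g₀ ∈ char_Λ X`,
`n ≥ 0`. Let `f_E` generate `char_Λ X` (principal) and `g₀ = h · f_E`; `D.mu = 0` says `f_E` has unit
content, i.e. `p ∤ f_E` in `Λ` (Greenberg–Vatsal (1)–(2)); `L_p(f, α) = ι G` with `G ∈ Λ`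
(Greenberg–Vatsal Prop. 3.7, tree theorem `exists_iwasawaToPowerSeries_eq_padicLFunction`); so
`h · f_E = p^n · G` in the UFD `Λ`, whose prime `p` (`IwasawaAlgebra.prime_C`) then divides `h` `n`
times: `h = p^n h'`, `h' · f_E = G`, and `g := ϖ · h' · f_E ∈ char_Λ X` has `ι g = ϖ · L_p(f, α)`
(`ϖ` a `p`-adic unit: `hϖ0`, `hϖv`). The `μ = 0` twin of `divisibility_of_kato_of_surjective_pow` (X10 gen 5,
Kato clause (3)). [cite: Kato2004Asterisque, Thm. 17.4 (2) (p. 273)]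
[cite: GreenbergVatsal2000, p. 2 (1)–(2) and Prop. (3.7)] [cite: Washington1997, §13.1] -/
theorem divisibility_of_kato_of_mu_eq_zero
    (W : WeierstrassCurve ℚ) [W.IsElliptic] [W.IsGloballyMinimal] (p : ℕ) [Fact p.Prime]
    {κ : ZpExtension ℚ p} {γ : Field.absoluteGaloisGroup ℚ} {N : ℕ} [NeZero N]
    {f : CuspForm (Gamma0 N) 2}
    (hK : kato_divisibility W p (κ := κ) (γ := γ) (f := f))
    (hp : p ≠ 2) (hgood : W.HasGoodReductionAtPrime p) (hord : ¬ (p : ℤ) ∣ W.frobeniusTrace p)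
    (hirr : W.HasIrreducibleModPGaloisRep p)
    (hκ : κ.IsCyclotomic) (hγ : κ.IsTopGenerator γ) (hγ' : IsCyclotomicVariable p γ)
    (hf : IsNewformOf W f) (D : W.SelmerDualData κ γ) (hμ : D.mu = 0)
    (ϖ : ℚ) (hϖ0 : ϖ ≠ 0) (hϖv : padicValRat p ϖ = 0) :
    D.IsTorsion ∧ ∃ g ∈ D.charIdeal, iwasawaToPowerSeries p g =
      PowerSeries.C ((ϖ : ℚ) : ℚ_[p]) * padicLFunction f (unitRoot W p : ℚ_[p]) := by
  have hordp : IsOrdinaryAt W p := ⟨hgood, hord⟩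
  -- `ϖ` is a unit of `ℤ_p`
  have hϖ : ‖(ϖ : ℚ_[p])‖ = 1 := by
    rw [Padic.eq_padicNorm, padicNorm.eq_zpow_of_nonzero hϖ0, hϖv, neg_zero, zpow_zero, Rat.cast_one]
  obtain ⟨hX, ⟨n, g₀, hg₀, hι₀⟩, -⟩ := hK hp hordp hκ hγ hγ' hf D
  haveI : Module.Finite (IwasawaAlgebra p) D.X := D.module_finite_holds hγ
  -- a generator `fE` of the (principal) characteristic ideal
  haveI : (Module.charIdeal (IwasawaAlgebra p) D.X).IsPrincipal := charIdeal_isPrincipal_holds p D.X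
  obtain ⟨fE, hchar⟩ := Submodule.IsPrincipal.principal (Module.charIdeal (IwasawaAlgebra p) D.X)
  have hchar' : D.charIdeal = Ideal.span {fE} := hchar
  -- `μ = 0`: `fE` has unit content, i.e. `p ∤ fE` in `Λ`
  have hfE : GreenbergVatsal2000.HasUnitContent fE :=
    (GreenbergVatsal2000.mu_eq_zero_iff_hasUnitContent D hX hchar').mp hμ
  have hndvd : ¬ (PowerSeries.C (p : ℤ_[p]) : IwasawaAlgebra p) ∣ fE :=
    (GreenbergVatsal2000.hasUnitContent_iff_not_C_dvd fE).mp hfE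
  -- `g₀ = h · fE`
  have hg₀' : g₀ ∈ Ideal.span {fE} := hchar' ▸ hg₀
  obtain ⟨h, hgh⟩ := Ideal.mem_span_singleton'.mp hg₀'
  -- `L_p(f, α) = ι G` with `G ∈ Λ` (irreducibility)
  obtain ⟨G, hG⟩ := exists_iwasawaToPowerSeries_eq_padicLFunction hp hordp hf hirr
  -- `g₀ = p^n · G` in `Λ` (`ι` is injective)
  have hιC : iwasawaToPowerSeries p ((PowerSeries.C (p : ℤ_[p]) : IwasawaAlgebra p) ^ n) =
      PowerSeries.C ((p : ℚ_[p]) ^ n) := by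
    rw [map_pow, PowerSeries.map_C, map_natCast, map_pow]
  have hg₀G : g₀ = (PowerSeries.C (p : ℤ_[p]) : IwasawaAlgebra p) ^ n * G := by
    apply iwasawaToPowerSeries_injective p
    rw [hι₀, map_mul, hιC, hG]
  -- the prime `p` of `Λ` divides `h` `n` times
  have hdvd : (PowerSeries.C (p : ℤ_[p]) : IwasawaAlgebra p) ^ n ∣ h * fE :=
    ⟨G, hgh.trans hg₀G⟩
  obtain ⟨h', hh'⟩ := (IwasawaAlgebra.prime_C p).pow_dvd_of_dvd_mul_right n hndvd hdvd
  have hpC0 : (PowerSeries.C (p : ℤ_[p]) : IwasawaAlgebra p) ^ n ≠ 0 :=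
    pow_ne_zero n (IwasawaAlgebra.prime_C p).ne_zero
  have hh'fE : h' * fE = G := by
    apply mul_left_cancel₀ hpC0
    rw [← hg₀G, ← hgh, hh', mul_assoc]
  set c : ℤ_[p] := ⟨(ϖ : ℚ_[p]), hϖ.le⟩ with hc_def
  refine ⟨hX, PowerSeries.C c * (h' * fE), Ideal.mul_mem_left _ _ ?_, ?_⟩
  · rw [hchar']
    exact Ideal.mem_span_singleton'.mpr ⟨h', rfl⟩
  · rw [map_mul, hh'fE, hG, PowerSeries.map_C]
    rfl

/-! ### §2. Odd good ordinary `p`, `E[p]` irreducible, `L(E,1) ≠ 0`, Greenberg's `μ = 0` at the pair -/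

section GreenbergMu

variable (W : WeierstrassCurve ℚ) [W.IsElliptic] [W.IsGloballyMinimal] (p : ℕ) [Fact p.Prime]

/-- **Greenberg's `μ = 0` ⟹ the Euler-system half `ord_p #Ш(E/ℚ) ≤ ord_p #Ш(E/ℚ)_an`** at an odd good
ordinary prime `p` with `E[p]` irreducible (ANY image — in particular a Cartan normaliser, where
neither Kato's clause (3) nor Wuthrich's Prop. 21 applies) and `L(E,1) ≠ 0`, granted the PUBLISHED
named facts Kato Thm. 17.4 (2) (`hK`, for the newform at level `N_E` and every cyclotomic datum),
Greenberg Thm. 4.1 (`hGr`), modularity with an integral Manin constant (`hmod`),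
Gross–Zagier–Kolyvagin (`hGZK`), and the period unit (`hϖ`); HYPOTHESIS `hμ`: `μ(X(E/ℚ_∞)) = 0` for
every cyclotomic datum (Greenberg LNM 1716 Conj. 1.11, OPEN). Proof: §1 datum + the cell's chain
`chain_of_divisibility` (a). The `μ = 0` twin of `missingUpperBoundAt_of_kato_of_surjective_pow`.
[cite: Kato2004Asterisque, Thm. 17.4 (2) (p. 273)] [cite: GreenbergLNM1716, §1 Conj. 1.11 and Thm. 4.1 (p. 102)]
[cite: Wuthrich2014, Prop. 21 (p. 400)] [cite: Miller2011LMS, Def. 1.1 (arXiv:1010.2431 p. 3)] -/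
theorem missingUpperBoundAt_of_kato_of_greenbergMu (hGr : greenberg_charValue_rankZero)
    (hmod : nonempty_modularParametrizationData)
    (hGZK : rank_eq_analyticRank_of_analyticRank_le_one)
    (hK : ∀ (κ : ZpExtension ℚ p) (γ : Field.absoluteGaloisGroup ℚ) [NeZero (W.conductorNorm ℤ)]
      (f : CuspForm (Gamma0 (W.conductorNorm ℤ)) 2), kato_divisibility W p (κ := κ) (γ := γ) (f := f))
    (hp : p ≠ 2) (hgood : W.HasGoodReductionAtPrime p) (hord : ¬ (p : ℤ) ∣ W.frobeniusTrace p)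
    (hirr : W.HasIrreducibleModPGaloisRep p) (hL : W.entireLFunction 1 ≠ 0)
    (hϖ : ∀ [NeZero (W.conductorNorm ℤ)] (f : CuspForm (Gamma0 (W.conductorNorm ℤ)) 2),
      IsNewformOf W f → ∀ ϖ : ℚ, (ϖ : ℝ) * W.realPeriodRat = plusPeriod f → padicValRat p ϖ = 0)
    (hμ : ∀ (κ : ZpExtension ℚ p) (γ : Field.absoluteGaloisGroup ℚ),
        κ.IsCyclotomic → κ.IsTopGenerator γ → IsCyclotomicVariable p γ →
      ∀ (D : W.SelmerDualData κ γ), D.mu = 0) :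
    Typed.MissingUpperBoundAt W p := by
  -- finiteness of `Ш` (Gross–Zagier–Kolyvagin at analytic rank `0`)
  have hr0 : W.analyticRank = 0 := analyticRank_eq_zero_of_entireLFunction_one_ne_zero W hL
  obtain ⟨-, hfin⟩ := hGZK W (by rw [hr0]; exact zero_le_one)
  -- the newform at level `N_E` and its period ratio `ϖ` (a `p`-adic unit by `hϖ`)
  haveI : NeZero (W.conductorNorm ℤ) := ⟨(W.conductorNorm_pos_holds).ne'⟩
  obtain ⟨Dm⟩ := hmod W
  have hf : IsNewformOf W Dm.f := Dm.isNewformOf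
  obtain ⟨ϖ, hϖpos, hϖeq, -⟩ := Dm.exists_rat_mul_realPeriodRat_eq_plusPeriod
  -- the cyclotomic datum, the Iwasawa module, the `μ = 0` datum, the chain
  obtain ⟨κ, hκ, γ, hγ, hγ'⟩ := exists_isCyclotomic_isTopGenerator_isCyclotomicVariable_holds p
  obtain ⟨D⟩ := W.nonempty_selmerDualData_holds κ γ hγ
  have hdiv := divisibility_of_kato_of_mu_eq_zero W p (hK κ γ Dm.f) hp hgood hord hirr hκ hγ hγ' hf D
    (hμ κ γ hκ hγ hγ' D) ϖ hϖpos.ne' (hϖ Dm.f hf ϖ hϖeq)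
  obtain ⟨t, ht, hle, -⟩ :=
    chain_of_divisibility hGr W p hp hgood hord hL hfin hκ hγ hγ' hf D ϖ hϖeq hdiv
  -- Miller's currency: `#Ш_an = t · #E(ℚ)² / ∏ c_ℓ`
  obtain ⟨-, hE, -, hshaAn⟩ := shaAn_eq_of_L_one_div_eq hGZK W hL ht
  haveI := hE
  have hΩ : (W.realPeriodRat : ℂ) ≠ 0 := by exact_mod_cast W.realPeriodRat_pos_holds.ne'
  have ht0 : t ≠ 0 := by
    rintro rfl
    apply hL
    rw [Rat.cast_zero, div_eq_zero_iff] at ht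
    exact ht.resolve_right hΩ
  have hcard : (Nat.card W.toAffine.Point : ℚ) ≠ 0 := by
    exact_mod_cast (Nat.card_pos (α := W.toAffine.Point)).ne'
  have htam : (W.tamagawaProduct : ℚ) ≠ 0 := by
    exact_mod_cast (W.tamagawaProduct_pos_holds : 0 < W.tamagawaProduct).ne'
  have hcardT : (Nat.card W.toAffine.Point : ℚ) = (W.torsionOrder : ℚ) := by
    exact_mod_cast (W.torsionOrder_eq_natCard_of_finite).symm
  refine ⟨t * (Nat.card W.toAffine.Point : ℚ) ^ 2 / (W.tamagawaProduct : ℚ), hshaAn, ?_⟩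
  rw [padicValRat.div (mul_ne_zero ht0 (pow_ne_zero 2 hcard)) htam,
    padicValRat.mul ht0 (pow_ne_zero 2 hcard), padicValRat.pow, hcardT]
  simp only [padicValRat.of_nat, Nat.cast_ofNat]
  linarith

/-- **Greenberg's `μ = 0` + the typed lower bound ⟹ Mazur's main conjecture for `(E, p)`** at an odd
good ordinary prime `p` with `E[p]` irreducible (any image) and `L(E,1) ≠ 0`. Facts: Kato Thm. 17.4 (2)
(`hK`), Greenberg Thm. 4.1 (`hGr`), Gross–Zagier–Kolyvagin (`hGZK`), the period unit (`hϖ`).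
Hypotheses: `hμ` (Greenberg's Conj. 1.11 at the pair, every cyclotomic datum) and
`Typed.MissingLowerBoundAt W p` (`#Ш_an = q ∈ ℚ`, `ord_p q ≤ ord_p #Ш`). Conclusion: Mazur's main
conjecture in the Néron normalisation at every datum `(κ, γ, f, ϖ, D)` with `f` of level `N_E` —
literally the body of `MazurMainConjecture W p`. The `μ = 0` twin of
`mainConjecture_of_missingLowerBoundAt_of_kato` (chain (b): the reverse inequality forces the cofactor
to be a unit of `Λ`). [cite: Kato2004Asterisque, Thm. 17.4 (2) (p. 273)]
[cite: GreenbergLNM1716, §1 Conj. 1.11, Thm. 4.1 and §5 (closing examples)]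
[cite: Miller2011LMS, Def. 1.1 (arXiv:1010.2431 p. 3)] -/
theorem mainConjecture_of_missingLowerBoundAt_of_kato_of_greenbergMu (hGr : greenberg_charValue_rankZero)
    (hGZK : rank_eq_analyticRank_of_analyticRank_le_one)
    (hK : ∀ (κ : ZpExtension ℚ p) (γ : Field.absoluteGaloisGroup ℚ) [NeZero (W.conductorNorm ℤ)]
      (f : CuspForm (Gamma0 (W.conductorNorm ℤ)) 2), kato_divisibility W p (κ := κ) (γ := γ) (f := f))
    (hp : p ≠ 2) (hgood : W.HasGoodReductionAtPrime p) (hord : ¬ (p : ℤ) ∣ W.frobeniusTrace p)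
    (hirr : W.HasIrreducibleModPGaloisRep p) (hL : W.entireLFunction 1 ≠ 0)
    (hϖ : ∀ [NeZero (W.conductorNorm ℤ)] (f : CuspForm (Gamma0 (W.conductorNorm ℤ)) 2),
      IsNewformOf W f → ∀ ϖ : ℚ, (ϖ : ℝ) * W.realPeriodRat = plusPeriod f → padicValRat p ϖ = 0)
    (hμ : ∀ (κ : ZpExtension ℚ p) (γ : Field.absoluteGaloisGroup ℚ),
        κ.IsCyclotomic → κ.IsTopGenerator γ → IsCyclotomicVariable p γ →
      ∀ (D : W.SelmerDualData κ γ), D.mu = 0)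
    (hlow : Typed.MissingLowerBoundAt W p) :
    ∀ (κ : ZpExtension ℚ p) (γ : Field.absoluteGaloisGroup ℚ),
        κ.IsCyclotomic → κ.IsTopGenerator γ → IsCyclotomicVariable p γ →
      ∀ [NeZero (W.conductorNorm ℤ)] (f : CuspForm (Gamma0 (W.conductorNorm ℤ)) 2),
        IsNewformOf W f → ∀ (ϖ : ℚ), (ϖ : ℝ) * W.realPeriodRat = plusPeriod f →
      ∀ (D : W.SelmerDualData κ γ), D.IsTorsion ∧
        ∃ g : IwasawaAlgebra p, D.charIdeal = Ideal.span {g} ∧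
          iwasawaToPowerSeries p g =
            PowerSeries.C (ϖ : ℚ_[p]) * padicLFunction f (unitRoot W p : ℚ_[p]) := by
  intro κ γ hκ hγ hγ' _ f hf ϖ hϖeq D
  have hr0 : W.analyticRank = 0 := analyticRank_eq_zero_of_entireLFunction_one_ne_zero W hL
  obtain ⟨-, hfin⟩ := hGZK W (by rw [hr0]; exact zero_le_one)
  have hϖ0 : ϖ ≠ 0 := varpi_ne_zero_of_entireLFunction_one_ne_zero W hL hf hϖeq
  have hdiv := divisibility_of_kato_of_mu_eq_zero W p (hK κ γ f) hp hgood hord hirr hκ hγ hγ' hf D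
    (hμ κ γ hκ hγ hγ' D) ϖ hϖ0 (hϖ f hf ϖ hϖeq)
  obtain ⟨t, ht, -, hconv⟩ :=
    chain_of_divisibility hGr W p hp hgood hord hL hfin hκ hγ hγ' hf D ϖ hϖeq hdiv
  apply hconv
  -- the reverse inequality at `t`, from the typed lower bound in Miller's currency
  obtain ⟨-, hE, -, hshaAn⟩ := shaAn_eq_of_L_one_div_eq hGZK W hL ht
  haveI := hE
  obtain ⟨q', hq', hle'⟩ := hlow
  have hqq : q' = t * (Nat.card W.toAffine.Point : ℚ) ^ 2 / (W.tamagawaProduct : ℚ) := by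
    exact_mod_cast hq'.symm.trans hshaAn
  have hΩ : (W.realPeriodRat : ℂ) ≠ 0 := by exact_mod_cast W.realPeriodRat_pos_holds.ne'
  have ht0 : t ≠ 0 := by
    rintro rfl
    apply hL
    rw [Rat.cast_zero, div_eq_zero_iff] at ht
    exact ht.resolve_right hΩ
  have hcard : (Nat.card W.toAffine.Point : ℚ) ≠ 0 := by
    exact_mod_cast (Nat.card_pos (α := W.toAffine.Point)).ne'
  have htam : (W.tamagawaProduct : ℚ) ≠ 0 := by
    exact_mod_cast (W.tamagawaProduct_pos_holds : 0 < W.tamagawaProduct).ne'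
  have hcardT : (Nat.card W.toAffine.Point : ℚ) = (W.torsionOrder : ℚ) := by
    exact_mod_cast (W.torsionOrder_eq_natCard_of_finite).symm
  rw [hqq, padicValRat.div (mul_ne_zero ht0 (pow_ne_zero 2 hcard)) htam,
    padicValRat.mul ht0 (pow_ne_zero 2 hcard), padicValRat.pow, hcardT] at hle'
  simp only [padicValRat.of_nat, Nat.cast_ofNat] at hle'
  linarith

/-- **Greenberg's `μ = 0` + Miller's `BSD(E, p)` ⟹ Mazur's main conjecture for `(E, p)`** at an odd good
ordinary prime `p` with `E[p]` irreducible (any image) and `L(E,1) ≠ 0` (same facts). `BSDp W p`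
contains `ord_p #Ш_an = ord_p #Ш(p)`, whose lower half feeds
`mainConjecture_of_missingLowerBoundAt_of_kato_of_greenbergMu`. So every certified instance of the
rank-`0` BSD formula at such a prime is an instance of Mazur's main conjecture MODULO Greenberg's
`μ = 0` at that pair — with no surjectivity (Kato clause (3)), no (ram) (Skinner–Urban Thm. 3.6.9)
and no rational main conjecture (Yan–Zhu Thm. 4.9 / BCS (a)). [cite: Kato2004Asterisque, Thm. 17.4 (2) (p. 273)]
[cite: GreenbergLNM1716, §1 Conj. 1.11 and §5 (closing examples)] [cite: Miller2011LMS, Def. 1.1 (arXiv:1010.2431 p. 3)] -/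
theorem mainConjecture_of_bsdp_of_kato_of_greenbergMu (hGr : greenberg_charValue_rankZero)
    (hGZK : rank_eq_analyticRank_of_analyticRank_le_one)
    (hK : ∀ (κ : ZpExtension ℚ p) (γ : Field.absoluteGaloisGroup ℚ) [NeZero (W.conductorNorm ℤ)]
      (f : CuspForm (Gamma0 (W.conductorNorm ℤ)) 2), kato_divisibility W p (κ := κ) (γ := γ) (f := f))
    (hp : p ≠ 2) (hgood : W.HasGoodReductionAtPrime p) (hord : ¬ (p : ℤ) ∣ W.frobeniusTrace p)
    (hirr : W.HasIrreducibleModPGaloisRep p) (hL : W.entireLFunction 1 ≠ 0)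
    (hϖ : ∀ [NeZero (W.conductorNorm ℤ)] (f : CuspForm (Gamma0 (W.conductorNorm ℤ)) 2),
      IsNewformOf W f → ∀ ϖ : ℚ, (ϖ : ℝ) * W.realPeriodRat = plusPeriod f → padicValRat p ϖ = 0)
    (hμ : ∀ (κ : ZpExtension ℚ p) (γ : Field.absoluteGaloisGroup ℚ),
        κ.IsCyclotomic → κ.IsTopGenerator γ → IsCyclotomicVariable p γ →
      ∀ (D : W.SelmerDualData κ γ), D.mu = 0)
    (hbsd : BSDp W p) :
    ∀ (κ : ZpExtension ℚ p) (γ : Field.absoluteGaloisGroup ℚ),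
        κ.IsCyclotomic → κ.IsTopGenerator γ → IsCyclotomicVariable p γ →
      ∀ [NeZero (W.conductorNorm ℤ)] (f : CuspForm (Gamma0 (W.conductorNorm ℤ)) 2),
        IsNewformOf W f → ∀ (ϖ : ℚ), (ϖ : ℝ) * W.realPeriodRat = plusPeriod f →
      ∀ (D : W.SelmerDualData κ γ), D.IsTorsion ∧
        ∃ g : IwasawaAlgebra p, D.charIdeal = Ideal.span {g} ∧
          iwasawaToPowerSeries p g =
            PowerSeries.C (ϖ : ℚ_[p]) * padicLFunction f (unitRoot W p : ℚ_[p]) := by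
  have hr0 : W.analyticRank = 0 := analyticRank_eq_zero_of_entireLFunction_one_ne_zero W hL
  obtain ⟨-, hfin⟩ := hGZK W (by rw [hr0]; exact zero_le_one)
  haveI : Finite W.sha := hfin
  exact mainConjecture_of_missingLowerBoundAt_of_kato_of_greenbergMu W p hGr hGZK hK hp hgood hord hirr
    hL hϖ hμ (Typed.lower_and_upper_of_missingPPartAt W p (Typed.missingPPartAt_of_bsdp W p hbsd)).1

/-- **Under Greenberg's `μ = 0`: Mazur's main conjecture ⟺ the typed lower bound** at an odd good
ordinary prime `p` with `E[p]` irreducible (any image) and `L(E,1) ≠ 0`, granted Kato Thm. 17.4 (2)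
(`hK`), Greenberg Thm. 4.1 (`hGr`), modularity (`hmod`), GZK (`hGZK`) and the period unit (`hϖ`): the
main conjecture for `(E, p)` (Néron normalisation, every datum, newform of level `N_E`) holds IF AND
ONLY IF `ord_p #Ш(E/ℚ)_an ≤ ord_p #Ш(E/ℚ)`. (⇒ is Castella–Grossi–Lee–Skinner's glue
`missingPPartAt_of_mainConjecture`, image-free and `μ`-free.) [cite: Kato2004Asterisque, Thm. 17.4 (2) (p. 273)]
[cite: GreenbergLNM1716, §1 Conj. 1.11, Thm. 4.1 and §5 (closing examples)] [cite: CastellaEtAl2021, Thm. 5.1.4 (proof)] -/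
theorem mainConjecture_iff_missingLowerBoundAt_of_kato_of_greenbergMu (hGr : greenberg_charValue_rankZero)
    (hmod : nonempty_modularParametrizationData)
    (hGZK : rank_eq_analyticRank_of_analyticRank_le_one)
    (hK : ∀ (κ : ZpExtension ℚ p) (γ : Field.absoluteGaloisGroup ℚ) [NeZero (W.conductorNorm ℤ)]
      (f : CuspForm (Gamma0 (W.conductorNorm ℤ)) 2), kato_divisibility W p (κ := κ) (γ := γ) (f := f))
    (hp : p ≠ 2) (hgood : W.HasGoodReductionAtPrime p) (hord : ¬ (p : ℤ) ∣ W.frobeniusTrace p)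
    (hirr : W.HasIrreducibleModPGaloisRep p) (hL : W.entireLFunction 1 ≠ 0)
    (hϖ : ∀ [NeZero (W.conductorNorm ℤ)] (f : CuspForm (Gamma0 (W.conductorNorm ℤ)) 2),
      IsNewformOf W f → ∀ ϖ : ℚ, (ϖ : ℝ) * W.realPeriodRat = plusPeriod f → padicValRat p ϖ = 0)
    (hμ : ∀ (κ : ZpExtension ℚ p) (γ : Field.absoluteGaloisGroup ℚ),
        κ.IsCyclotomic → κ.IsTopGenerator γ → IsCyclotomicVariable p γ →
      ∀ (D : W.SelmerDualData κ γ), D.mu = 0) :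
    (∀ (κ : ZpExtension ℚ p) (γ : Field.absoluteGaloisGroup ℚ),
        κ.IsCyclotomic → κ.IsTopGenerator γ → IsCyclotomicVariable p γ →
      ∀ [NeZero (W.conductorNorm ℤ)] (f : CuspForm (Gamma0 (W.conductorNorm ℤ)) 2),
        IsNewformOf W f → ∀ (ϖ : ℚ), (ϖ : ℝ) * W.realPeriodRat = plusPeriod f →
      ∀ (D : W.SelmerDualData κ γ), D.IsTorsion ∧
        ∃ g : IwasawaAlgebra p, D.charIdeal = Ideal.span {g} ∧
          iwasawaToPowerSeries p g =
            PowerSeries.C (ϖ : ℚ_[p]) * padicLFunction f (unitRoot W p : ℚ_[p])) ↔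
    Typed.MissingLowerBoundAt W p := by
  constructor
  · intro hMC
    exact (Typed.lower_and_upper_of_missingPPartAt W p
      (missingPPartAt_of_mainConjecture hGr hmod hGZK W p hp hgood hord hL hMC)).1
  · exact mainConjecture_of_missingLowerBoundAt_of_kato_of_greenbergMu W p hGr hGZK hK hp hgood hord
      hirr hL hϖ hμ

/-- **Under Greenberg's `μ = 0`: Mazur's main conjecture ⟺ Miller's `BSD(E, p)`** at an odd good ordinary
prime `p` with `E[p]` irreducible (any image) and `L(E,1) ≠ 0` (same facts as
`mainConjecture_iff_missingLowerBoundAt_of_kato_of_greenbergMu`). [cite: Kato2004Asterisque, Thm. 17.4 (2) (p. 273)]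
[cite: GreenbergLNM1716, §1 Conj. 1.11, Thm. 4.1 and §5 (closing examples)] [cite: Miller2011LMS, Def. 1.1 (arXiv:1010.2431 p. 3)] -/
theorem mainConjecture_iff_bsdp_of_kato_of_greenbergMu (hGr : greenberg_charValue_rankZero)
    (hmod : nonempty_modularParametrizationData)
    (hGZK : rank_eq_analyticRank_of_analyticRank_le_one)
    (hK : ∀ (κ : ZpExtension ℚ p) (γ : Field.absoluteGaloisGroup ℚ) [NeZero (W.conductorNorm ℤ)]
      (f : CuspForm (Gamma0 (W.conductorNorm ℤ)) 2), kato_divisibility W p (κ := κ) (γ := γ) (f := f))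
    (hp : p ≠ 2) (hgood : W.HasGoodReductionAtPrime p) (hord : ¬ (p : ℤ) ∣ W.frobeniusTrace p)
    (hirr : W.HasIrreducibleModPGaloisRep p) (hL : W.entireLFunction 1 ≠ 0)
    (hϖ : ∀ [NeZero (W.conductorNorm ℤ)] (f : CuspForm (Gamma0 (W.conductorNorm ℤ)) 2),
      IsNewformOf W f → ∀ ϖ : ℚ, (ϖ : ℝ) * W.realPeriodRat = plusPeriod f → padicValRat p ϖ = 0)
    (hμ : ∀ (κ : ZpExtension ℚ p) (γ : Field.absoluteGaloisGroup ℚ),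
        κ.IsCyclotomic → κ.IsTopGenerator γ → IsCyclotomicVariable p γ →
      ∀ (D : W.SelmerDualData κ γ), D.mu = 0) :
    (∀ (κ : ZpExtension ℚ p) (γ : Field.absoluteGaloisGroup ℚ),
        κ.IsCyclotomic → κ.IsTopGenerator γ → IsCyclotomicVariable p γ →
      ∀ [NeZero (W.conductorNorm ℤ)] (f : CuspForm (Gamma0 (W.conductorNorm ℤ)) 2),
        IsNewformOf W f → ∀ (ϖ : ℚ), (ϖ : ℝ) * W.realPeriodRat = plusPeriod f →
      ∀ (D : W.SelmerDualData κ γ), D.IsTorsion ∧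
        ∃ g : IwasawaAlgebra p, D.charIdeal = Ideal.span {g} ∧
          iwasawaToPowerSeries p g =
            PowerSeries.C (ϖ : ℚ_[p]) * padicLFunction f (unitRoot W p : ℚ_[p])) ↔
    BSDp W p := by
  have hr0 : W.analyticRank = 0 := analyticRank_eq_zero_of_entireLFunction_one_ne_zero W hL
  constructor
  · intro hMC
    exact Typed.bsdp_of_missingPPartAt W p hGZK (by rw [hr0]; exact zero_le_one)
      (missingPPartAt_of_mainConjecture hGr hmod hGZK W p hp hgood hord hL hMC)
  · exact mainConjecture_of_bsdp_of_kato_of_greenbergMu W p hGr hGZK hK hp hgood hord hirr hL hϖ hμ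

/-- **The converse bookkeeping: Mazur's main conjecture at a datum + ONE unit coefficient of
`ϖ · L_p(f, α)` ⟹ `μ(X(E/ℚ_∞)) = 0` at that datum** (any prime, any image; no named fact): the generator
`g` with `ι g = ϖ · L_p(f, α)` has unit content, which is `D.mu = 0` (Greenberg–Vatsal (1)–(2)). The
certificate `hcert` ("`μ^an = 0`", one coefficient of the Néron-normalised `3`-adic `L`-function is a
`p`-adic unit) is a finite modular-symbol computation per pair (cc-eng-6 route K / MU-CENSUS).
[cite: GreenbergVatsal2000, p. 2 (1)–(2)] -/
theorem mu_eq_zero_of_mainConjectureAt_of_cert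
    {κ : ZpExtension ℚ p} {γ : Field.absoluteGaloisGroup ℚ} (hγ : κ.IsTopGenerator γ)
    {N : ℕ} [NeZero N] {f : CuspForm (Gamma0 N) 2} (D : W.SelmerDualData κ γ) {ϖ : ℚ}
    (hMC : D.IsTorsion ∧ ∃ g : IwasawaAlgebra p, D.charIdeal = Ideal.span {g} ∧
      iwasawaToPowerSeries p g = PowerSeries.C (ϖ : ℚ_[p]) * padicLFunction f (unitRoot W p : ℚ_[p]))
    (hcert : ∃ n : ℕ, ‖PowerSeries.coeff n
        (PowerSeries.C (ϖ : ℚ_[p]) * padicLFunction f (unitRoot W p : ℚ_[p]))‖ = 1) :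
    D.mu = 0 := by
  haveI : Module.Finite (IwasawaAlgebra p) D.X := D.module_finite_holds hγ
  obtain ⟨hX, g, hchar, hιg⟩ := hMC
  refine (GreenbergVatsal2000.mu_eq_zero_iff_hasUnitContent D hX hchar).mpr ?_
  rw [GreenbergVatsal2000.hasUnitContent_iff_exists_norm_coeff_map_eq_one, hιg]
  exact hcert

end GreenbergMu

end Summit.BirchSwinnertonDyer.Rank1Residual.X10

end
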